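import Literature.Probability.LatticeModels.RandomCurrentsProofs
import Literature.Probability.LatticeModels.GriffithsMonotonicity
import Literature.Probability.Percolation.PercolationEvents
import Mathlib.Algebra.BigOperators.Ring.Nat
import Mathlib.Algebra.Order.Sub.Prod
import HarnessLib

/-!
# The switching lemma for random currents (nested graphs, sources prescribed in a volume)

Trunk G02 (T-STATMECH), topic `Probability/LatticeModels`, namespace `Literature.StatMech`
(dot-notation extensions in `Literature.Probability.LatticeModels.Current`). This file proves the **switching lemma** of
Griffiths–Hurst–Sherman (1970) / Aizenman (1982) in the nested form used by

* M. Aizenman, H. Duminil-Copin, V. Sidoravicius, *Random currents and continuity of Ising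
  model's spontaneous magnetization*, Comm. Math. Phys. **334** (2015) 719–742, Lemma 2.2
  (arXiv:1311.1937v3; bib key `AizenmanDuminilCopinSidoraviciusCMP2015`, "ADS15"):
  for `Λ₀ ⊂ Λ`, `x, y ∈ Λ₀`, `A ⊂ Λ` and `F : Ω_Λ → ℝ`,
  `∑_{∂n₁ = {x,y}, ∂n₂ = A} F(n₁+n₂) w(n₁)w(n₂)
     = ∑_{∂n₁ = ∅, ∂n₂ = A Δ {x,y}} F(n₁+n₂) w(n₁)w(n₂) 𝟙[x ↔ y in Λ₀ through n₁+n₂]`,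
  `n₁` ranging over currents on the smaller edge set;
* H. Duminil-Copin, *Random currents expansion of the Ising model*, arXiv:1607.06933 (2016),
  Lemma 2.2 and its proof ("fix the multigraph `ℳ = n₁ + n₂` … the map `𝒩 ↦ 𝒩 Δ 𝒦`").

## Relation to the tree

`RandomCurrentsProofs.lean` (Part II) proves the classical same-graph switching lemma
`currentSum_switching_holds` (both currents on `E(G)`, sources prescribed exactly) by labelled
sub-currents. ADS15 needs the **nested** form — `n₁` on the smaller edge set `E(G₁)`, the sources
of `n₂` prescribed only inside `Λ` (the `+` current with frozen boundary vertices), connection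
through `E(G₁)` — which is not a special case of that statement (the support of `n₁` and the
`Λ`-restricted source constraint are not functions of `n₁ + n₂`); it is proved here independently,
by characters. The weight identity `w(n)w(m-n) = w(m) binom(m,n)` and `∂(m-n) = ∂m Δ ∂n` are the
tree's `Current.weight_mul_weight_tsub` / `Current.sources_tsub` (re-derived inline where used).

## Setting and statement

One finite graph `G` on `V` (currents `Current G = (G.edgeFinset → ℕ)`, `RandomCurrents.lean`)
and a subgraph `G₁` (the "smaller edge set" `Λ₀`; no inclusion hypothesis is needed for the
statements, the relevant edges being `E(G₁) ∩ E(G)`). The first current `n₁` is required to be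
**supported on `E(G₁)`** (`Current.IsSupp G₁ n₁`; the embedding `Current.extend` of currents of
`G₁ ≤ G` identifies these with the currents of `G₁`, preserving weights, degrees, sources and
traces), its sources are prescribed exactly (`∂n₁ = A`), while the sources of `n₂` are prescribed
only inside a volume `Λ` (`∂n₂ ∩ Λ = B`, the `+`-boundary-condition constraint of
`PlusCurrents.lean`; `Λ = univ` is the classical case). The connection event is
`x ↔ y` through edges of `G₁` carrying positive total current (`Current.connIn`). The theorem
`Current.tsum_switching` states, for bounded `F`,

`∑_{(n₁,n₂)} 𝟙[n₁ ⊆ E(G₁), ∂n₁ = A] 𝟙[∂n₂ ∩ Λ = B] w(n₁)w(n₂) F(n₁+n₂) 𝟙[x ↔ y]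
  = ∑_{(n₁,n₂)} 𝟙[n₁ ⊆ E(G₁), ∂n₁ = A Δ {x} Δ {y}] 𝟙[∂n₂ ∩ Λ = B Δ (({x} Δ {y}) ∩ Λ)] w(n₁)w(n₂)
      F(n₁+n₂) 𝟙[x ↔ y]`,

and `Current.reachable_of_sources_eq` supplies `𝟙[x ↔ y] = 1` on `{∂n₁ = {x} Δ {y}}`, so that
the indicator may be dropped on that side (ADS15 (3.2), Duminil-Copin 2016 Lemma 2.2 verbatim
when `Λ = univ`).

## Proof

Resummation over the total current `m = n₁ + n₂` (`Current.tsum_prod_weight_mul_eq`):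
`w(n₁)w(m - n₁) = w(m) ∏_e C(m_e, n₁,e)`, so a double sum
becomes `∑_m w(m) ∑_{n ≤ m} binom(m,n) Ψ(n, m-n)`; and `∂(m - n) = ∂m Δ ∂n`. The combinatorial
heart — for `x ↔ y` in `m` through `E(G₁)`,
`∑_{n ≤ m, n ⊆ E(G₁), ∂n = A} binom(m,n) = ∑_{n ≤ m, n ⊆ E(G₁), ∂n = A Δ {x}Δ{y}} binom(m,n)`
(`Current.switchCount_symmDiff`) — is proved by characters instead of the bijection `𝒩 ↦ 𝒩 Δ 𝒦`:
`2^{|V|} 𝟙[∂n = A] = ∑_σ σ_A ∏_e σ_e^{n_e}` (`sum_spinProduct_mul_prod_bondSpin_pow`) and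
`∑_{n} binom(m,n) ∏_e σ_e^{n_e} = ∏_{e ∈ E(G₁)} (1 + σ_e)^{m_e}`, which vanishes unless `σ` is
constant along every edge of `E(G₁)` carrying current, whence `σ_x = σ_y` and
`σ_A = σ_{A Δ {x} Δ {y}}` on the support. The parity fact "a current whose odd vertices inside
`Λ` are `x ≠ y` and whose `x`-cluster stays in `Λ` connects `x` to `y`"
(`Current.reachable_of_sources_inter_eq`) is the handshake identity on the cluster of `x`.

## Mathlib status

No random currents in Mathlib. Anchors: `Fintype.piFinset`, `Finset.prod_univ_sum`, `add_pow`,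
`Nat.choose_mul_factorial_mul_factorial`, `Function.Injective.tsum_eq`,
`Function.Injective.summable_iff`, `Summable.tsum_prod`, `Equiv.tsum_eq`, `tsum_eq_sum`,
`Finset.even_sum_iff_even_card_odd`, `SimpleGraph.Walk` induction, `SimpleGraph.fromEdgeSet`
(`openGraph`, `openGraph_mono` of `PercolationEvents.lean`).
-/

noncomputable section

open MeasureTheory Finset Filter Topology
open scoped symmDiff

namespace Literature.Probability.LatticeModels

variable {V : Type*} [Fintype V] [DecidableEq V] {G : SimpleGraph V} [DecidableRel G.Adj]

namespace Current

/-! ### Sub-currents and binomial weights -/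

/-- The binomial weight `binom(m,n) = ∏_e C(m_e, n_e)`: the number of sub-multigraphs of the
multigraph `m` (with `m_e` distinguishable copies of the edge `e`) projecting to the current `n`
(Duminil-Copin 2016, proof of Lemma 2.2, "`ℳ` the multigraph of `n₁ + n₂`"). [cite: DuminilCopin2016, proof of Lemma 2.2] -/
def binom (m n : Current G) : ℕ := ∏ e, (m e).choose (n e)

/-- The finite set of currents below `m` (`n ≤ m` pointwise). [cite: DuminilCopin2016, proof of Lemma 2.2] -/
def below (m : Current G) : Finset (Current G) := Fintype.piFinset fun e => range (m e + 1)

/-- `n ∈ below m ↔ n ≤ m`. [folklore] -/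
theorem mem_below_iff {m n : Current G} : n ∈ m.below ↔ n ≤ m := by
  simp only [below, Fintype.mem_piFinset, Finset.mem_range, Nat.lt_succ_iff]
  rfl

/-- One edge: `β^a/a! · β^{c-a}/(c-a)! = β^c/c! · C(c,a)` for `a ≤ c`. [folklore] -/
theorem pow_div_factorial_mul {a c : ℕ} (h : a ≤ c) (β : ℝ) :
    β ^ a / (a.factorial : ℝ) * (β ^ (c - a) / ((c - a).factorial : ℝ)) =
      β ^ c / (c.factorial : ℝ) * (c.choose a : ℝ) := by
  have hc : ((c.choose a : ℕ) : ℝ) * (a.factorial : ℝ) * ((c - a).factorial : ℝ) = (c.factorial : ℝ) := by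
    exact_mod_cast Nat.choose_mul_factorial_mul_factorial h
  have ha : (a.factorial : ℝ) ≠ 0 := by positivity
  have hca : ((c - a).factorial : ℝ) ≠ 0 := by positivity
  have hcf : (c.factorial : ℝ) ≠ 0 := by positivity
  rw [div_mul_div_comm, ← pow_add, Nat.add_sub_cancel' h, div_mul_eq_mul_div, div_eq_div_iff
    (mul_ne_zero ha hca) hcf, ← hc]
  ring

/-- **Resummation over the total current.** For a bounded `Ψ`,
`∑_{(n₁,n₂)} w(n₁) w(n₂) Ψ(n₁, n₂) = ∑_m w(m) ∑_{n ≤ m} binom(m,n) Ψ(n, m - n)`: reindex by the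
injection `(n₁,n₂) ↦ (n₁, n₁+n₂)` and sum over the (finite) fibres (Duminil-Copin 2016, proof of
Lemma 2.2, first display). All series converge absolutely (`∑_n w_{|β|}(n) < ∞`). [cite: DuminilCopin2016, proof of Lemma 2.2] -/
theorem tsum_prod_weight_mul_eq (β : ℝ) (Ψ : Current G → Current G → ℝ)
    (hΨ : ∃ C, ∀ n₁ n₂, |Ψ n₁ n₂| ≤ C) :
    ∑' p : Current G × Current G, p.1.weight β * p.2.weight β * Ψ p.1 p.2 =
      ∑' m : Current G, m.weight β * ∑ n ∈ m.below, (binom m n : ℝ) * Ψ n (m - n) := by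
  classical
  obtain ⟨C, hC⟩ := hΨ
  -- `w(n) w(m - n) = w(m) binom(m,n)` for `n ≤ m` (Duminil-Copin 2016, proof of Lemma 2.2; the
  -- tree's `Current.weight_mul_weight_tsub` of `RandomCurrentsProofs.lean`, here with `binom`)
  have hwb : ∀ {m n : Current G}, n ≤ m →
      n.weight β * (m - n).weight β = m.weight β * (binom m n : ℝ) := by
    intro m n h
    unfold weight binom
    rw [Nat.cast_prod, ← Finset.prod_mul_distrib, ← Finset.prod_mul_distrib]
    exact Finset.prod_congr rfl fun e _ => pow_div_factorial_mul (h e) β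
  set f : Current G × Current G → ℝ := fun p => p.1.weight β * p.2.weight β * Ψ p.1 p.2 with hf_def
  -- absolute convergence
  have hf : Summable f := by
    have h1 := summable_weight_abs G β
    have h2 : Summable fun p : Current G × Current G => p.1.weight |β| * p.2.weight |β| :=
      h1.mul_of_nonneg h1 (fun n => weight_nonneg (abs_nonneg β) n)
        (fun n => weight_nonneg (abs_nonneg β) n)
    refine (h2.mul_left C).of_norm_bounded fun p => ?_
    rw [Real.norm_eq_abs, hf_def, abs_mul, abs_mul, abs_weight, abs_weight]
    have hw : 0 ≤ p.1.weight |β| * p.2.weight |β| :=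
      mul_nonneg (weight_nonneg (abs_nonneg β) _) (weight_nonneg (abs_nonneg β) _)
    calc p.1.weight |β| * p.2.weight |β| * |Ψ p.1 p.2|
        ≤ p.1.weight |β| * p.2.weight |β| * C := mul_le_mul_of_nonneg_left (hC _ _) hw
      _ = C * (p.1.weight |β| * p.2.weight |β|) := by ring
  -- the injection `(n₁, n₂) ↦ (n₁, n₁ + n₂)` and the extended function
  set j : Current G × Current G → Current G × Current G := fun p => (p.1, p.1 + p.2) with hj_def
  have hj : Function.Injective j := by
    rintro ⟨a, b⟩ ⟨c, d⟩ h
    simp only [hj_def, Prod.mk.injEq] at h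
    obtain ⟨rfl, h2⟩ := h
    exact Prod.ext rfl (add_left_cancel h2)
  set g : Current G × Current G → ℝ := fun q =>
    if q.1 ≤ q.2 then q.1.weight β * (q.2 - q.1).weight β * Ψ q.1 (q.2 - q.1) else 0 with hg_def
  have hgj : ∀ p, g (j p) = f p := by
    intro p
    simp only [hg_def, hj_def, hf_def]
    rw [if_pos le_self_add, add_tsub_cancel_left]
  have hg0 : ∀ q, q ∉ Set.range j → g q = 0 := by
    intro q hq
    by_cases h : q.1 ≤ q.2
    · exact absurd ⟨(q.1, q.2 - q.1), Prod.ext rfl (add_tsub_cancel_of_le h)⟩ hq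
    · exact if_neg h
  have hsupp : Function.support g ⊆ Set.range j := by
    intro q hq
    by_contra h
    exact hq (hg0 q h)
  have hgf : g ∘ j = f := funext hgj
  have hg : Summable g := (hj.summable_iff hg0).1 (by rw [hgf]; exact hf)
  have h1 : ∑' p, f p = ∑' q, g q := by
    rw [← hj.tsum_eq hsupp]
    exact tsum_congr fun p => (hgj p).symm
  -- swap the factors and sum fibrewise
  have hg' : Summable (g ∘ (Equiv.prodComm (Current G) (Current G))) :=
    hg.comp_injective (Equiv.prodComm _ _).injective
  have h2 : ∑' q, g q = ∑' m, ∑' n, g (n, m) := by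
    rw [← (Equiv.prodComm (Current G) (Current G)).tsum_eq g]
    exact hg'.tsum_prod
  have h3 : ∀ m : Current G,
      ∑' n, g (n, m) = m.weight β * ∑ n ∈ m.below, (binom m n : ℝ) * Ψ n (m - n) := by
    intro m
    rw [tsum_eq_sum (s := m.below) fun n hn => by
      rw [mem_below_iff] at hn; exact if_neg hn, Finset.mul_sum]
    refine Finset.sum_congr rfl fun n hn => ?_
    rw [mem_below_iff] at hn
    simp only [hg_def]
    rw [if_pos hn, hwb hn]
    ring
  change ∑' p, f p = _
  rw [h1, h2]
  exact tsum_congr h3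

/-! ### Currents supported on a subgraph -/

section Traced

variable (G₁ : SimpleGraph V)

/-- The trace of a current inside `E(G₁)`: the edges of `G₁` carrying positive current
(ADS15: "`x ↔ y` in `Λ₀`", connection through `n̂₁+n₂` restricted to `𝒫₂(Λ₀)`). [cite: AizenmanDuminilCopinSidoraviciusCMP2015, Lemma 2.2] -/
def tracedIn (n : Current G) : Percolation.BondConfig V := {e | e ∈ G₁.edgeSet ∧ e ∈ n.traced}

omit [DecidableEq V] in
/-- The restricted trace is part of the trace. [folklore] -/
theorem tracedIn_subset_traced (n : Current G) : n.tracedIn G₁ ⊆ n.traced := fun _ h => h.2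

omit [DecidableEq V] in
/-- The restricted trace is monotone in the current. [folklore] -/
theorem tracedIn_mono {n n' : Current G} (h : n ≤ n') : n.tracedIn G₁ ⊆ n'.tracedIn G₁ := by
  rintro e ⟨he₁, he⟩
  refine ⟨he₁, ?_⟩
  obtain ⟨hG, hpos⟩ := he
  exact ⟨hG, lt_of_lt_of_le hpos (h _)⟩

/-- The connection event "`x ↔ y` through edges of `G₁` carrying positive current" on currents of
`G` (ADS15 Lemma 2.2, `𝟙[x ↔ y in Λ₀]` as a function of `n₁ + n₂`). [cite: AizenmanDuminilCopinSidoraviciusCMP2015, Lemma 2.2] -/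
def connIn (x y : V) : Set (Current G) := {n | (Percolation.openGraph (n.tracedIn G₁)).Reachable x y}

omit [DecidableEq V] in
/-- Membership in the connection event. [cite: AizenmanDuminilCopinSidoraviciusCMP2015, Lemma 2.2] -/
theorem mem_connIn_iff {x y : V} {n : Current G} :
    n ∈ connIn G₁ x y ↔ (Percolation.openGraph (n.tracedIn G₁)).Reachable x y :=
  Iff.rfl

omit [DecidableEq V] in
/-- The connection event is increasing. [folklore] -/
theorem connIn_mono {x y : V} {n n' : Current G} (h : n ≤ n') (hn : n ∈ connIn G₁ x y) :
    n' ∈ connIn G₁ x y :=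
  hn.mono (Percolation.openGraph_mono (tracedIn_mono G₁ h))

end Traced

section Supported

variable (G₁ : SimpleGraph V) [DecidableRel G₁.Adj]

/-- A current of `G` is *supported on `G₁`* if it vanishes on the edges of `G` that are not edges
of `G₁` (ADS15 Lemma 2.2: `n₁ ∈ Ω_{Λ₀}` regarded as an element of `Ω_Λ`). [cite: AizenmanDuminilCopinSidoraviciusCMP2015, Lemma 2.2] -/
def IsSupp (n : Current G) : Prop := ∀ e : G.edgeFinset, (e : Sym2 V) ∉ G₁.edgeFinset → n e = 0

/-- Being supported on `G₁` is decidable. [folklore] -/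
instance (n : Current G) : Decidable (IsSupp G₁ n) := by
  unfold IsSupp; infer_instance

omit [DecidableEq V] in
/-- The zero current is supported on every subgraph. [folklore] -/
theorem isSupp_zero : IsSupp G₁ (0 : Current G) := fun _ _ => rfl

/-- The currents below `m` supported on `G₁`. [cite: DuminilCopin2016, proof of Lemma 2.2] -/
def belowIn (m : Current G) : Finset (Current G) :=
  Fintype.piFinset fun e => if (e : Sym2 V) ∈ G₁.edgeFinset then range (m e + 1) else range 1

/-- `n ∈ belowIn m ↔ n ≤ m ∧ n` is supported on `G₁`. [folklore] -/
theorem mem_belowIn_iff {m n : Current G} : n ∈ m.belowIn G₁ ↔ n ≤ m ∧ IsSupp G₁ n := by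
  simp only [belowIn, Fintype.mem_piFinset, IsSupp]
  constructor
  · intro h
    refine ⟨fun e => ?_, fun e he => ?_⟩
    · have := h e
      split_ifs at this with he
      · exact Nat.lt_succ_iff.1 (Finset.mem_range.1 this)
      · have h0 : n e = 0 := by simpa using this
        rw [h0]; exact Nat.zero_le _
    · have := h e
      rw [if_neg he] at this
      simpa using this
  · rintro ⟨hle, hsupp⟩ e
    split_ifs with he
    · exact Finset.mem_range.2 (Nat.lt_succ_iff.2 (hle e))
    · rw [hsupp e he]; simp

/-- `belowIn m` is the part of `below m` supported on `G₁`. [folklore] -/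
theorem belowIn_eq_filter (m : Current G) : m.belowIn G₁ = m.below.filter (IsSupp G₁) := by
  ext n
  rw [mem_belowIn_iff, Finset.mem_filter, mem_below_iff]

/-- **The switching count** `S_m(A) = ∑_{n ≤ m, n ⊆ E(G₁), ∂n = A} binom(m,n)`: the number of
sub-multigraphs of `m` inside `E(G₁)` with odd-degree set `A` (Duminil-Copin 2016, proof of
Lemma 2.2, `#{𝒩 ⊆ ℳ : ∂𝒩 = A}`). [cite: DuminilCopin2016, proof of Lemma 2.2] -/
def switchCount (m : Current G) (A : Finset V) : ℝ :=
  ∑ n ∈ m.belowIn G₁, if n.sources = A then (binom m n : ℝ) else 0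

/-- The edge factor of the character expansion: `(1 + σ_e)^{m_e}` on `E(G₁)`, `1` elsewhere. [cite: DuminilCopin2016, proof of Lemma 2.2] -/
def edgeFactor (m : Current G) (σ : SpinConfig V) (e : G.edgeFinset) : ℝ :=
  if (e : Sym2 V) ∈ G₁.edgeFinset then (bondSpin σ e + 1) ^ m e else 1

/-- One edge of the character expansion: `∑_{k ∈ t_e} C(m_e,k) σ_e^k` equals `(σ_e + 1)^{m_e}` on
`E(G₁)` (binomial theorem) and `C(m_e,0) = 1` elsewhere. [folklore] -/
theorem sum_choose_mul_pow_eq_edgeFactor (m : Current G) (σ : SpinConfig V) (e : G.edgeFinset) :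
    ∑ k ∈ (if (e : Sym2 V) ∈ G₁.edgeFinset then range (m e + 1) else range 1),
        ((m e).choose k : ℝ) * bondSpin σ e ^ k = edgeFactor G₁ m σ e := by
  unfold edgeFactor
  split_ifs with he
  · rw [add_pow]
    refine Finset.sum_congr rfl fun k _ => ?_
    rw [one_pow, mul_one, mul_comm]
  · simp

/-- **Character expansion of the switching count** (the algebraic form of "`#{𝒩 ⊆ ℳ : ∂𝒩 = A}`"):
`2^{|V|} S_m(A) = ∑_σ σ_A ∏_e edgeFactor_m(σ, e)`, from
`2^{|V|} 𝟙[∂n = A] = ∑_σ σ_A ∏_e σ_e^{n_e}` and `∑_{n ≤ m|_{E(G₁)}} ∏_e C(m_e,n_e) σ_e^{n_e}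
= ∏_{e ∈ E(G₁)} (1 + σ_e)^{m_e}`. [cite: DuminilCopin2016, proof of Lemma 2.2] -/
theorem two_pow_mul_switchCount (m : Current G) (A : Finset V) :
    (2 : ℝ) ^ Fintype.card V * switchCount G₁ m A =
      ∑ σ : SpinConfig V, spinProduct A σ * ∏ e : G.edgeFinset, edgeFactor G₁ m σ e := by
  unfold switchCount
  rw [Finset.mul_sum]
  have h1 : ∀ n ∈ m.belowIn G₁, (2 : ℝ) ^ Fintype.card V * (if n.sources = A then (binom m n : ℝ) else 0)
      = (binom m n : ℝ) * ∑ σ : SpinConfig V, spinProduct A σ *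
          ∏ e : G.edgeFinset, bondSpin σ (e : Sym2 V) ^ n e := by
    intro n _
    rw [sum_spinProduct_mul_prod_bondSpin_pow G A n]
    split_ifs <;> ring
  rw [Finset.sum_congr rfl h1]
  simp_rw [Finset.mul_sum]
  rw [Finset.sum_comm]
  refine Finset.sum_congr rfl fun σ _ => ?_
  -- `∑_{n ∈ belowIn m} binom(m,n) σ_A ∏_e σ_e^{n_e} = σ_A ∏_e edgeFactor`
  have h2 : ∀ n : Current G, (binom m n : ℝ) * (spinProduct A σ *
      ∏ e : G.edgeFinset, bondSpin σ (e : Sym2 V) ^ n e) =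
      spinProduct A σ * ∏ e : G.edgeFinset, (((m e).choose (n e) : ℝ) * bondSpin σ e ^ n e) := by
    intro n
    rw [Finset.prod_mul_distrib, binom, Nat.cast_prod]
    ring
  simp_rw [h2]
  rw [← Finset.mul_sum, belowIn,
    ← Finset.prod_univ_sum _ (fun (e : G.edgeFinset) (k : ℕ) => ((m e).choose k : ℝ) * bondSpin σ e ^ k)]
  simp_rw [sum_choose_mul_pow_eq_edgeFactor]

omit [Fintype V] [DecidableEq V] in
/-- Along an edge of `E(G₁)` carrying current, a configuration with non-vanishing edge factors is
constant: `(1 + σ_uσ_v)^{m_e} ≠ 0`, `m_e ≥ 1` force `σ_u = σ_v`. [cite: DuminilCopin2016, proof of Lemma 2.2] -/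
theorem spinAt_eq_of_adj_of_ne_zero {u v : V} {σ : SpinConfig V} {k : ℕ} (hk : 0 < k)
    (h : (bondSpin σ s(u, v) + 1) ^ k ≠ 0) : spinAt u σ = spinAt v σ := by
  by_contra hne
  apply h
  have hprod : spinAt u σ * spinAt v σ = -1 := by
    rcases spinAt_eq_one_or_eq_neg_one u σ with hu | hu <;>
      rcases spinAt_eq_one_or_eq_neg_one v σ with hv | hv <;>
      simp_all
  rw [bondSpin_mk, hprod, neg_add_cancel, zero_pow hk.ne']

/-- **Constancy along the cluster**: if `∏_e edgeFactor_m(σ,e) ≠ 0` and `x ↔ y` through edges of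
`E(G₁)` carrying current, then `σ_x = σ_y` (induction along an open path). [cite: DuminilCopin2016, proof of Lemma 2.2] -/
theorem spinAt_eq_of_reachable {m : Current G} {σ : SpinConfig V}
    (hσ : ∏ e : G.edgeFinset, edgeFactor G₁ m σ e ≠ 0) {x y : V}
    (hxy : (Percolation.openGraph (m.tracedIn G₁)).Reachable x y) : spinAt x σ = spinAt y σ := by
  obtain ⟨p⟩ := hxy
  induction p with
  | nil => rfl
  | @cons u v w huv p ih =>
    refine Eq.trans ?_ ih
    rw [Percolation.openGraph_adj] at huv
    obtain ⟨⟨h₁, hG, hpos⟩, _⟩ := huv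
    have he : edgeFactor G₁ m σ ⟨s(u, v), hG⟩ ≠ 0 := fun h0 =>
      hσ (Finset.prod_eq_zero (Finset.mem_univ _) h0)
    unfold edgeFactor at he
    rw [if_pos (SimpleGraph.mem_edgeFinset.2 h₁)] at he
    exact spinAt_eq_of_adj_of_ne_zero hpos he

omit [Fintype V] in
/-- `σ_{{x} Δ {y}} = σ_x σ_y`, hence `= 1` when `σ_x = σ_y`. [folklore] -/
theorem spinProduct_symmDiff_singleton_eq_one {x y : V} {σ : SpinConfig V}
    (h : spinAt x σ = spinAt y σ) : spinProduct ({x} ∆ {y}) σ = 1 := by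
  by_cases hxy : x = y
  · subst hxy; simp [spinProduct]
  · have hd : ({x} : Finset V) ∆ {y} = {x, y} := by
      ext w
      simp only [Finset.mem_symmDiff, Finset.mem_singleton, Finset.mem_insert]
      constructor
      · rintro (⟨h, _⟩ | ⟨h, _⟩)
        · exact Or.inl h
        · exact Or.inr h
      · rintro (rfl | rfl)
        · exact Or.inl ⟨rfl, hxy⟩
        · exact Or.inr ⟨rfl, fun h => hxy h.symm⟩
    rw [hd, spinProduct, Finset.prod_pair hxy, h, spinAt_mul_self]

/-- **The switching symmetry of the counts** (Duminil-Copin 2016, Lemma 2.2, the bijection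
`𝒩 ↦ 𝒩 Δ 𝒦` along a path `𝒦` from `x` to `y`): if `x ↔ y` through edges of `E(G₁)` carrying
`m`-current, then `S_m(A) = S_m(A Δ {x} Δ {y})` for every `A`. Proved by characters: on the
support of `∏_e edgeFactor`, `σ_x = σ_y` and `σ_{A Δ {x} Δ {y}} = σ_A σ_x σ_y = σ_A`. [cite: DuminilCopin2016, Lemma 2.2] -/
theorem switchCount_symmDiff {m : Current G} {x y : V}
    (hconn : (Percolation.openGraph (m.tracedIn G₁)).Reachable x y) (A : Finset V) :
    switchCount G₁ m A = switchCount G₁ m (A ∆ ({x} ∆ {y})) := by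
  have h2 : (2 : ℝ) ^ Fintype.card V ≠ 0 := by positivity
  apply mul_left_cancel₀ h2
  rw [two_pow_mul_switchCount, two_pow_mul_switchCount]
  refine Finset.sum_congr rfl fun σ _ => ?_
  by_cases hσ : ∏ e : G.edgeFinset, edgeFactor G₁ m σ e = 0
  · rw [hσ, mul_zero, mul_zero]
  · rw [← spinProduct_mul_spinProduct, spinProduct_symmDiff_singleton_eq_one
      (spinAt_eq_of_reachable G₁ hσ hconn), mul_one]

end Supported

/-! ### The parity lemma: sources and clusters -/

omit [DecidableEq V] in
/-- Traced edges are edges of `G`. [folklore] -/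
theorem traced_subset_edgeSet (n : Current G) : n.traced ⊆ G.edgeSet := by
  rintro e ⟨he, -⟩
  exact SimpleGraph.mem_edgeFinset.1 he

/-- **Handshake on a cluster**: the `x`-cluster `C` of the trace of `n` contains an even number of
sources of `n` — every traced edge meets `C` in `0` or `2` vertices, so `∑_{v ∈ C} deg_n(v)` is
even (ADS15 §3.2, the argument behind (3.7); Duminil-Copin 2016, §2.1, "a current with sources
`{x,y}` contains a path from `x` to `y`"). [cite: AizenmanDuminilCopinSidoraviciusCMP2015, §3.2, eq. (3.7)] -/
theorem even_card_sources_cluster (n : Current G) (x : V) (C : Finset V)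
    (hC : ∀ v, v ∈ C ↔ (Percolation.openGraph n.traced).Reachable x v) :
    Even #(C.filter fun v => v ∈ n.sources) := by
  have hfilter : C.filter (fun v => v ∈ n.sources) = C.filter (fun v => Odd (n.degree v)) := by
    ext v; simp only [Finset.mem_filter, mem_sources_iff]
  rw [hfilter, ← Finset.even_sum_iff_even_card_odd]
  -- `∑_{v ∈ C} deg v = ∑_e n_e #{v ∈ C : v ∈ e}`
  have hsum : ∑ v ∈ C, n.degree v =
      ∑ e : G.edgeFinset, n e * #(C.filter fun v => v ∈ (e : Sym2 V)) := by
    unfold degree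
    rw [Finset.sum_comm]
    refine Finset.sum_congr rfl fun e _ => ?_
    rw [← Finset.sum_filter, Finset.sum_const, smul_eq_mul, mul_comm]
  rw [hsum]
  refine Finset.even_sum _ fun e _ => ?_
  rcases Nat.eq_zero_or_pos (n e) with h0 | hpos
  · rw [h0, zero_mul]; exact Even.zero
  · refine Nat.even_mul.2 (Or.inr ?_)
    obtain ⟨e, he⟩ := e
    induction e using Sym2.ind with
    | _ a b =>
      have hab : a ≠ b := G.ne_of_adj (SimpleGraph.mem_edgeFinset.1 he)
      have hadj : (Percolation.openGraph n.traced).Adj a b := by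
        rw [Percolation.openGraph_adj]
        exact ⟨⟨he, hpos⟩, hab⟩
      have hiff : a ∈ C ↔ b ∈ C := by
        rw [hC, hC]
        exact ⟨fun h => h.trans hadj.reachable, fun h => h.trans hadj.symm.reachable⟩
      have hfil : C.filter (fun v => v ∈ (s(a, b) : Sym2 V)) = ({a, b} : Finset V).filter (· ∈ C) := by
        ext v
        simp only [Finset.mem_filter, Sym2.mem_iff, Finset.mem_insert, Finset.mem_singleton]
        tauto
      change Even #(C.filter fun v => v ∈ (s(a, b) : Sym2 V))
      rw [hfil, Finset.filter_insert, Finset.filter_singleton]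
      by_cases ha : a ∈ C
      · have hb : b ∈ C := hiff.1 ha
        rw [if_pos ha, if_pos hb, Finset.card_insert_of_notMem (by simpa using hab)]
        simp
      · have hb : b ∉ C := fun hb => ha (hiff.2 hb)
        rw [if_neg ha, if_neg hb]
        simp

/-- **The parity lemma** (ADS15 §3.2, proof of (3.7); Duminil-Copin 2016, §2.1): if the sources
of `n` inside `Λ` are exactly `{x} Δ {y}` with `x ≠ y`, `x ∈ Λ`, and the `x`-cluster of the trace
of `n` stays inside `Λ`, then `x ↔ y` in the trace of `n` (the cluster of `x` must contain a
second odd vertex, and `y` is the only candidate). [cite: AizenmanDuminilCopinSidoraviciusCMP2015, §3.2, eq. (3.7)] -/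
theorem reachable_of_sources_inter_eq {n : Current G} {Λ : Finset V} {x y : V} (hxy : x ≠ y)
    (hs : n.sources ∩ Λ = {x} ∆ {y})
    (hΛ : ∀ v, (Percolation.openGraph n.traced).Reachable x v → v ∈ Λ) :
    (Percolation.openGraph n.traced).Reachable x y := by
  classical
  by_contra hy
  set C : Finset V := univ.filter fun v => (Percolation.openGraph n.traced).Reachable x v with hC_def
  have hC : ∀ v, v ∈ C ↔ (Percolation.openGraph n.traced).Reachable x v := fun v => by simp [hC_def]
  have heven := even_card_sources_cluster n x C hC
  have hx : x ∈ n.sources ∩ Λ := by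
    rw [hs, Finset.mem_symmDiff]
    exact Or.inl ⟨Finset.mem_singleton_self x, by simpa using hxy⟩
  have hset : C.filter (fun v => v ∈ n.sources) = {x} := by
    ext v
    simp only [Finset.mem_filter, Finset.mem_singleton]
    constructor
    · rintro ⟨hvC, hv⟩
      have hvΛ : v ∈ Λ := hΛ v ((hC v).1 hvC)
      have hv' : v ∈ n.sources ∩ Λ := Finset.mem_inter.2 ⟨hv, hvΛ⟩
      rw [hs, Finset.mem_symmDiff, Finset.mem_singleton, Finset.mem_singleton] at hv'
      rcases hv' with ⟨rfl, _⟩ | ⟨rfl, _⟩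
      · rfl
      · exact absurd ((hC _).1 hvC) hy
    · intro hvx
      rw [hvx]
      exact ⟨(hC x).2 (SimpleGraph.Reachable.refl x), (Finset.mem_inter.1 hx).1⟩
  rw [hset, Finset.card_singleton] at heven
  exact Nat.not_even_one heven

/-- The classical case `Λ = univ`: a current with sources `{x} Δ {y}`, `x ≠ y`, connects `x` to
`y` (Duminil-Copin 2016, §2.1; used in Lemma 2.2 to drop `𝟙[x ↔ y]` on `{∂n₁ = {x,y}}`). [cite: DuminilCopin2016, §2.1] -/
theorem reachable_of_sources_eq {n : Current G} {x y : V} (hxy : x ≠ y)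
    (hs : n.sources = {x} ∆ {y}) : (Percolation.openGraph n.traced).Reachable x y :=
  reachable_of_sources_inter_eq (Λ := univ) hxy (by rw [Finset.inter_univ, hs]) fun _ _ =>
    Finset.mem_univ _

section Supported2

variable (G₁ : SimpleGraph V) [DecidableRel G₁.Adj]

omit [DecidableEq V] [DecidableRel G₁.Adj] in
/-- **Connections inside `Λ` use edges of `G₁`**: if every vertex of the `x`-cluster of the trace
of `n` lies in `Λ`, and every edge of `G` inside `Λ` is an edge of `G₁`, then an open path from
`x` is open in the restricted trace `n.tracedIn G₁` (ADS15 §3.2, (3.6)–(3.7): a connection not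
reaching `δ` is a connection "in `Λ`"). [cite: AizenmanDuminilCopinSidoraviciusCMP2015, §3.2, eqs. (3.6)–(3.7)] -/
theorem reachable_tracedIn_of_forall_mem {n : Current G} {Λ : Finset V} {x y : V}
    (hΛ : ∀ v, (Percolation.openGraph n.traced).Reachable x v → v ∈ Λ)
    (hG : ∀ a b, a ∈ Λ → b ∈ Λ → G.Adj a b → G₁.Adj a b)
    (h : (Percolation.openGraph n.traced).Reachable x y) : (Percolation.openGraph (n.tracedIn G₁)).Reachable x y := by
  suffices key : ∀ (u v : V) (p : (Percolation.openGraph n.traced).Walk u v),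
      (Percolation.openGraph n.traced).Reachable x u → (Percolation.openGraph (n.tracedIn G₁)).Reachable x u →
        (Percolation.openGraph (n.tracedIn G₁)).Reachable x v by
    obtain ⟨p⟩ := h
    exact key x y p (SimpleGraph.Reachable.refl x) (SimpleGraph.Reachable.refl x)
  intro u v p
  induction p with
  | nil => exact fun _ h => h
  | @cons u w v huw p ih =>
    intro hxu hxu'
    have hxw : (Percolation.openGraph n.traced).Reachable x w := hxu.trans huw.reachable
    refine ih hxw (hxu'.trans (SimpleGraph.Adj.reachable ?_))
    rw [Percolation.openGraph_adj] at huw ⊢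
    obtain ⟨he, hne⟩ := huw
    have hGadj : G.Adj u w := (SimpleGraph.mem_edgeSet G).1 (traced_subset_edgeSet n he)
    exact ⟨⟨(SimpleGraph.mem_edgeSet G₁).2 (hG u w (hΛ u hxu) (hΛ w hxw) hGadj), he⟩, hne⟩

omit [DecidableRel G₁.Adj] in
/-- **ADS15 (3.7), the exit alternative**: if the sources of `n` inside `Λ` are `{x} Δ {y}`
(`x ≠ y`, `x ∈ Λ`), every edge of `G` inside `Λ` is an edge of `G₁`, and `x` is *not* connected
to `y` through edges of `G₁` carrying current, then the `x`-cluster of the trace of `n` leaves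
`Λ`: `x ↔ v` for some `v ∉ Λ` ("`x ↔ δ`"). [cite: AizenmanDuminilCopinSidoraviciusCMP2015, §3.2, eq. (3.7)] -/
theorem exists_reachable_notMem_of_not_connIn {n : Current G} {Λ : Finset V} {x y : V}
    (hxy : x ≠ y) (hs : n.sources ∩ Λ = {x} ∆ {y})
    (hG : ∀ a b, a ∈ Λ → b ∈ Λ → G.Adj a b → G₁.Adj a b)
    (hconn : ¬(Percolation.openGraph (n.tracedIn G₁)).Reachable x y) :
    ∃ v, v ∉ Λ ∧ (Percolation.openGraph n.traced).Reachable x v := by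
  by_contra hcon
  have hΛ : ∀ v, (Percolation.openGraph n.traced).Reachable x v → v ∈ Λ := fun v hv =>
    by_contra fun hvΛ => hcon ⟨v, hvΛ, hv⟩
  exact hconn (reachable_tracedIn_of_forall_mem G₁ hΛ hG
    (reachable_of_sources_inter_eq hxy hs hΛ))

omit [DecidableEq V] in
/-- A current supported on `G₁` traces only edges of `G₁`: `n.traced = n.tracedIn G₁`. [folklore] -/
theorem tracedIn_eq_traced_of_isSupp {n : Current G} (hn : IsSupp G₁ n) :
    n.tracedIn G₁ = n.traced := by
  refine Set.Subset.antisymm (tracedIn_subset_traced G₁ n) fun e he => ⟨?_, he⟩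
  obtain ⟨hG, hpos⟩ := he
  by_contra h₁
  have := hn ⟨e, hG⟩ (fun h => h₁ (SimpleGraph.mem_edgeFinset.1 h))
  omega

/-- **Dropping the indicator** (Duminil-Copin 2016, Lemma 2.2: on `{∂n₁ = {x,y}}` the event
`x ↔ y` in `n₁ + n₂` holds automatically): a current `n₁` supported on `G₁` with
`∂n₁ = {x} Δ {y}` connects `x` to `y` through `E(G₁)` inside `n₁ + n₂`. [cite: DuminilCopin2016, Lemma 2.2] -/
theorem add_mem_connIn_of_sources_eq {n₁ : Current G} (hn : IsSupp G₁ n₁) {x y : V}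
    (hs : n₁.sources = {x} ∆ {y}) (n₂ : Current G) : n₁ + n₂ ∈ connIn G₁ x y := by
  refine connIn_mono G₁ (le_self_add : n₁ ≤ n₁ + n₂) ?_
  rw [mem_connIn_iff, tracedIn_eq_traced_of_isSupp G₁ hn]
  by_cases hxy : x = y
  · subst hxy; exact SimpleGraph.Reachable.refl x
  · exact reachable_of_sources_eq hxy hs

/-! ### The switching lemma -/

/-- The `m`-resolved form of one side of the switching lemma: with
`Ψ_{A,B}(n₁,n₂) = 𝟙[n₁ ⊆ E(G₁), ∂n₁ = A] 𝟙[∂n₂ ∩ Λ = B] H(n₁+n₂)`, for `n ≤ m`,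
`∑_{n ≤ m} binom(m,n) Ψ_{A,B}(n, m-n) = H(m) 𝟙[(∂m Δ A) ∩ Λ = B] S_m(A)`. [cite: DuminilCopin2016, proof of Lemma 2.2] -/
theorem sum_below_binom_mul_eq (m : Current G) (Λ A B : Finset V) (H : Current G → ℝ) :
    ∑ n ∈ m.below, (binom m n : ℝ) *
        ((if IsSupp G₁ n ∧ n.sources = A then (1 : ℝ) else 0) *
          (if (m - n).sources ∩ Λ = B then (1 : ℝ) else 0) * H (n + (m - n))) =
      H m * (if (m.sources ∆ A) ∩ Λ = B then 1 else 0) * switchCount G₁ m A := by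
  unfold switchCount
  rw [belowIn_eq_filter, Finset.sum_filter, Finset.mul_sum]
  refine Finset.sum_congr rfl fun n hn => ?_
  rw [mem_below_iff] at hn
  -- `∂(m - n) = ∂m Δ ∂n` (the tree's `Current.sources_tsub`, from `Current.sources_add`)
  have hst : (m - n).sources = m.sources ∆ n.sources := by
    have hm : m.sources = ((m - n) + n).sources := by rw [tsub_add_cancel_of_le hn]
    rw [hm, sources_add, symmDiff_assoc, symmDiff_self, symmDiff_bot]
  rw [add_tsub_cancel_of_le hn, hst]
  by_cases hsupp : IsSupp G₁ n
  · by_cases hsA : n.sources = A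
    · rw [if_pos ⟨hsupp, hsA⟩, if_pos hsupp, if_pos hsA, hsA]; ring
    · rw [if_neg (fun h => hsA h.2), if_pos hsupp, if_neg hsA]; ring
  · rw [if_neg (fun h => hsupp h.1), if_neg hsupp]; ring

omit [Fintype V] in
/-- Set algebra of the source constraints: `((X Δ (A Δ D)) ∩ Λ = B Δ (D ∩ Λ)) ↔ ((X Δ A) ∩ Λ = B)`. [folklore] -/
theorem symmDiff_inter_eq_iff (X A D B Λ : Finset V) :
    (X ∆ (A ∆ D)) ∩ Λ = B ∆ (D ∩ Λ) ↔ (X ∆ A) ∩ Λ = B := by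
  have key : (X ∆ (A ∆ D)) ∩ Λ = ((X ∆ A) ∩ Λ) ∆ (D ∩ Λ) := by
    ext v
    simp only [Finset.mem_inter, Finset.mem_symmDiff]
    tauto
  rw [key]
  constructor
  · intro h
    have := congrArg (· ∆ (D ∩ Λ)) h
    simpa only [symmDiff_assoc, symmDiff_self, symmDiff_bot] using this
  · intro h
    rw [h]

/-- **The switching lemma** (Griffiths–Hurst–Sherman 1970; Aizenman 1982, Lemma 3.2; ADS15
Lemma 2.2; Duminil-Copin 2016, Lemma 2.2), nested form with sources of the second current
prescribed inside `Λ` only. For a finite graph `G`, a subgraph `G₁`, a volume `Λ`, vertices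
`x, y`, finite sets `A, B`, every real `β` and every bounded `F`,
`∑_{(n₁,n₂)} 𝟙[n₁ ⊆ E(G₁), ∂n₁ = A] 𝟙[∂n₂ ∩ Λ = B] w_β(n₁) w_β(n₂) F(n₁+n₂) 𝟙[x ↔ y in E(G₁)]`
`= ∑_{(n₁,n₂)} 𝟙[n₁ ⊆ E(G₁), ∂n₁ = A Δ {x} Δ {y}] 𝟙[∂n₂ ∩ Λ = B Δ (({x} Δ {y}) ∩ Λ)] w_β(n₁) w_β(n₂) F(n₁+n₂) 𝟙[x ↔ y in E(G₁)]`,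
where `x ↔ y in E(G₁)` refers to the trace of `n₁ + n₂` restricted to `E(G₁)` (`connIn`). With
`Λ = univ` and `A = {x} Δ {y}` (where the indicator on the left is `≡ 1`,
`add_mem_connIn_of_sources_eq`) this is Duminil-Copin 2016, Lemma 2.2 verbatim. [cite: AizenmanDuminilCopinSidoraviciusCMP2015, Lemma 2.2] -/
theorem tsum_switching (β : ℝ) (Λ A B : Finset V) (x y : V) (F : Current G → ℝ)
    (hF : ∃ C, ∀ m, |F m| ≤ C) :
    ∑' p : Current G × Current G,
        (if IsSupp G₁ p.1 ∧ p.1.sources = A then p.1.weight β else 0) *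
          (if p.2.sources ∩ Λ = B then p.2.weight β else 0) *
          (F (p.1 + p.2) * (connIn G₁ x y).indicator 1 (p.1 + p.2)) =
      ∑' p : Current G × Current G,
        (if IsSupp G₁ p.1 ∧ p.1.sources = A ∆ ({x} ∆ {y}) then p.1.weight β else 0) *
          (if p.2.sources ∩ Λ = B ∆ (({x} ∆ {y}) ∩ Λ) then p.2.weight β else 0) *
          (F (p.1 + p.2) * (connIn G₁ x y).indicator 1 (p.1 + p.2)) := by
  classical
  obtain ⟨C, hC⟩ := hF
  set H : Current G → ℝ := fun m => F m * (connIn G₁ x y).indicator 1 m with hH_def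
  have hH : ∀ m, |H m| ≤ C := by
    intro m
    simp only [hH_def, Set.indicator_apply, Pi.one_apply]
    split_ifs
    · rw [mul_one]; exact hC m
    · rw [mul_zero, abs_zero]; exact (abs_nonneg _).trans (hC m)
  -- both sides in the form of `tsum_prod_weight_mul_eq`
  set Ψ : Finset V → Finset V → Current G → Current G → ℝ := fun A' B' n₁ n₂ =>
    (if IsSupp G₁ n₁ ∧ n₁.sources = A' then (1 : ℝ) else 0) *
      (if n₂.sources ∩ Λ = B' then (1 : ℝ) else 0) * H (n₁ + n₂) with hΨ_def
  have hΨb : ∀ A' B', ∃ C', ∀ n₁ n₂, |Ψ A' B' n₁ n₂| ≤ C' := by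
    intro A' B'
    refine ⟨C, fun n₁ n₂ => ?_⟩
    simp only [hΨ_def]
    split_ifs <;> simp [hH, (abs_nonneg (H (n₁ + n₂))).trans (hH _)]
  have hre : ∀ A' B', ∑' p : Current G × Current G,
      (if IsSupp G₁ p.1 ∧ p.1.sources = A' then p.1.weight β else 0) *
        (if p.2.sources ∩ Λ = B' then p.2.weight β else 0) * H (p.1 + p.2) =
      ∑' m : Current G, m.weight β *
        (H m * (if (m.sources ∆ A') ∩ Λ = B' then 1 else 0) * switchCount G₁ m A') := by
    intro A' B'
    have h1 : ∀ p : Current G × Current G,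
        (if IsSupp G₁ p.1 ∧ p.1.sources = A' then p.1.weight β else 0) *
          (if p.2.sources ∩ Λ = B' then p.2.weight β else 0) * H (p.1 + p.2) =
        p.1.weight β * p.2.weight β * Ψ A' B' p.1 p.2 := by
      intro p; simp only [hΨ_def]; split_ifs <;> ring
    simp_rw [h1]
    rw [tsum_prod_weight_mul_eq β (Ψ A' B') (hΨb A' B')]
    refine tsum_congr fun m => ?_
    rw [sum_below_binom_mul_eq G₁ m Λ A' B' H]
  change ∑' p : Current G × Current G,
      (if IsSupp G₁ p.1 ∧ p.1.sources = A then p.1.weight β else 0) *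
        (if p.2.sources ∩ Λ = B then p.2.weight β else 0) * H (p.1 + p.2) =
    ∑' p : Current G × Current G,
      (if IsSupp G₁ p.1 ∧ p.1.sources = A ∆ ({x} ∆ {y}) then p.1.weight β else 0) *
        (if p.2.sources ∩ Λ = B ∆ (({x} ∆ {y}) ∩ Λ) then p.2.weight β else 0) * H (p.1 + p.2)
  rw [hre, hre]
  refine tsum_congr fun m => ?_
  have hite : (if (m.sources ∆ (A ∆ ({x} ∆ {y}))) ∩ Λ = B ∆ (({x} ∆ {y}) ∩ Λ) then (1 : ℝ) else 0) =
      if (m.sources ∆ A) ∩ Λ = B then 1 else 0 := by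
    by_cases hB : (m.sources ∆ A) ∩ Λ = B
    · rw [if_pos hB, if_pos ((symmDiff_inter_eq_iff _ _ _ _ _).2 hB)]
    · rw [if_neg hB, if_neg fun h => hB ((symmDiff_inter_eq_iff _ _ _ _ _).1 h)]
  rw [hite]
  by_cases hconn : (Percolation.openGraph (m.tracedIn G₁)).Reachable x y
  · rw [← switchCount_symmDiff G₁ hconn A]
  · have hH0 : H m = 0 := by
      simp only [hH_def, Set.indicator_apply, Set.mem_setOf_eq, connIn, if_neg hconn, mul_zero]
    rw [hH0]; ring

end Supported2

/-! ### Currents of a subgraph as supported currents -/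

section Extend

variable {G₁ : SimpleGraph V} [DecidableRel G₁.Adj]

/-- The extension by zero of a current of `G₁ ≤ G` to a current of `G` (ADS15 Lemma 2.2:
`n₁ ∈ Ω_{Λ₀}` as an element of `Ω_Λ`). [cite: AizenmanDuminilCopinSidoraviciusCMP2015, Lemma 2.2] -/
def extend (n : Current G₁) : Current G := fun e =>
  if he : (e : Sym2 V) ∈ G₁.edgeFinset then n ⟨e, he⟩ else 0

/-- The extension on an edge of `G₁`. [folklore] -/
theorem extend_apply_of_mem (n : Current G₁) (e : G.edgeFinset) (he : (e : Sym2 V) ∈ G₁.edgeFinset) :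
    extend (G := G) n e = n ⟨e, he⟩ := by
  simp [extend, he]

/-- The extension off `E(G₁)` vanishes. [folklore] -/
theorem extend_apply_of_not_mem (n : Current G₁) (e : G.edgeFinset) (he : (e : Sym2 V) ∉ G₁.edgeFinset) :
    extend (G := G) n e = 0 := by
  simp [extend, he]

/-- The extension is supported on `G₁`. [folklore] -/
theorem isSupp_extend (n : Current G₁) : IsSupp G₁ (extend (G := G) n) :=
  fun e he => extend_apply_of_not_mem n e he

variable (hle : G₁ ≤ G)
include hle

/-- The extension on an edge of `G₁`, in terms of the inclusion `E(G₁) ⊆ E(G)`. [folklore] -/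
theorem extend_apply_incl (n : Current G₁) (e : G₁.edgeFinset) :
    extend (G := G) n ⟨e, SimpleGraph.edgeFinset_subset_edgeFinset.2 hle e.2⟩ = n e := by
  rw [extend_apply_of_mem n ⟨e, SimpleGraph.edgeFinset_subset_edgeFinset.2 hle e.2⟩ e.2]

/-- The extension is injective. [folklore] -/
theorem extend_injective : Function.Injective (extend (G := G) (G₁ := G₁)) := by
  intro n n' h
  funext e
  have := congrFun h ⟨e, SimpleGraph.edgeFinset_subset_edgeFinset.2 hle e.2⟩
  rwa [extend_apply_incl hle, extend_apply_incl hle] at this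

/-- Every current of `G` supported on `G₁` is an extension. [folklore] -/
theorem exists_extend_eq_of_isSupp {n : Current G} (hn : IsSupp G₁ n) :
    ∃ n₁ : Current G₁, extend n₁ = n := by
  refine ⟨fun e => n ⟨e, SimpleGraph.edgeFinset_subset_edgeFinset.2 hle e.2⟩, funext fun e => ?_⟩
  by_cases he : (e : Sym2 V) ∈ G₁.edgeFinset
  · rw [extend_apply_of_mem _ e he]
  · rw [extend_apply_of_not_mem _ e he, hn e he]

/-- The range of the extension is the set of supported currents. [folklore] -/
theorem range_extend : Set.range (extend (G := G) (G₁ := G₁)) = {n | IsSupp G₁ n} :=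
  Set.Subset.antisymm (by rintro _ ⟨n, rfl⟩; exact isSupp_extend n)
    fun _ hn => exists_extend_eq_of_isSupp hle hn

/-- Extension preserves the weight (`β^0/0! = 1` on the new edges). [folklore] -/
theorem weight_extend (β : ℝ) (n : Current G₁) : (extend (G := G) n).weight β = n.weight β := by
  unfold weight
  set N : Sym2 V → ℝ := fun e =>
    if he : e ∈ G₁.edgeFinset then β ^ n ⟨e, he⟩ / ((n ⟨e, he⟩).factorial : ℝ) else 1 with hN
  have hL : ∀ e : G.edgeFinset, β ^ extend (G := G) n e / ((extend (G := G) n e).factorial : ℝ) = N e := by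
    intro e
    by_cases he : (e : Sym2 V) ∈ G₁.edgeFinset
    · rw [extend_apply_of_mem n e he]; simp only [hN, dif_pos he]
    · rw [extend_apply_of_not_mem n e he]
      simp only [hN, dif_neg he, pow_zero, Nat.factorial_zero, Nat.cast_one, div_one]
  have hR : ∀ e : G₁.edgeFinset, β ^ n e / ((n e).factorial : ℝ) = N e := by
    intro e; simp only [hN, dif_pos e.2]
  rw [Finset.prod_congr rfl fun e _ => hL e, Finset.prod_congr rfl fun e _ => hR e,
    Finset.prod_coe_sort G.edgeFinset N, Finset.prod_coe_sort G₁.edgeFinset N]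
  refine (Finset.prod_subset (SimpleGraph.edgeFinset_subset_edgeFinset.2 hle) fun e _ he => ?_).symm
  simp only [hN, dif_neg he]

/-- Extension preserves degrees. [folklore] -/
theorem degree_extend (n : Current G₁) (x : V) : (extend (G := G) n).degree x = n.degree x := by
  unfold degree
  set N : Sym2 V → ℕ := fun e =>
    if he : e ∈ G₁.edgeFinset then (if x ∈ e then n ⟨e, he⟩ else 0) else 0 with hN
  have hL : ∀ e : G.edgeFinset, (if x ∈ (e : Sym2 V) then extend (G := G) n e else 0) = N e := by
    intro e
    by_cases he : (e : Sym2 V) ∈ G₁.edgeFinset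
    · rw [extend_apply_of_mem n e he]; simp only [hN, dif_pos he]
    · rw [extend_apply_of_not_mem n e he]
      simp only [hN, dif_neg he, ite_self]
  have hR : ∀ e : G₁.edgeFinset, (if x ∈ (e : Sym2 V) then n e else 0) = N e := by
    intro e; simp only [hN, dif_pos e.2]
  rw [Finset.sum_congr rfl fun e _ => hL e, Finset.sum_congr rfl fun e _ => hR e,
    Finset.sum_coe_sort G.edgeFinset N, Finset.sum_coe_sort G₁.edgeFinset N]
  refine (Finset.sum_subset (SimpleGraph.edgeFinset_subset_edgeFinset.2 hle) fun e _ he => ?_).symm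
  simp only [hN, dif_neg he]

/-- Extension preserves sources. [folklore] -/
theorem sources_extend (n : Current G₁) : (extend (G := G) n).sources = n.sources := by
  ext x
  rw [mem_sources_iff, mem_sources_iff, degree_extend hle]

/-- Extension preserves the trace. [folklore] -/
theorem traced_extend (n : Current G₁) : (extend (G := G) n).traced = n.traced := by
  ext e
  constructor
  · rintro ⟨hG, hpos⟩
    by_cases he : e ∈ G₁.edgeFinset
    · rw [extend_apply_of_mem n _ he] at hpos
      exact ⟨he, hpos⟩
    · rw [extend_apply_of_not_mem n _ he] at hpos
      exact absurd hpos (lt_irrefl 0)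
  · rintro ⟨h₁, hpos⟩
    refine ⟨SimpleGraph.edgeFinset_subset_edgeFinset.2 hle h₁, ?_⟩
    rw [extend_apply_of_mem n _ h₁]
    exact hpos

/-- **Sums over currents of `G₁` as sums over supported currents of `G`**: for every `f`,
`∑_{n₁ : Current G₁} f(extend n₁) = ∑_{n : Current G} 𝟙[n ⊆ E(G₁)] f(n)`. [folklore] -/
theorem tsum_extend_eq {α : Type*} [AddCommMonoid α] [TopologicalSpace α] (f : Current G → α) :
    ∑' n₁ : Current G₁, f (extend n₁) = ∑' n : Current G, if IsSupp G₁ n then f n else 0 := by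
  rw [← (extend_injective hle).tsum_eq (f := fun n => if IsSupp G₁ n then f n else 0)]
  · exact tsum_congr fun n₁ => by rw [if_pos (isSupp_extend n₁)]
  · intro n hn
    rw [range_extend hle]
    by_contra h
    exact hn (if_neg h)

end Extend

end Current

end Literature.Probability.LatticeModels
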